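import Mathlib
import HarnessLib
import Summits.ValiantsHypothesis.ValiantsHypothesis.Theorems.MonotoneRestorationMonotoneRestorationQPLinearWidthHomIndistShift
import Summits.ValiantsHypothesis.ValiantsHypothesis.Theorems.MonotoneRestorationMonotoneRestorationQPLinearWidthMultiplierNoGo
import Literature.ModelTheory.FiniteModelTheory.CkEquivHomCount
import Literature.Combinatorics.SimpleGraph.TreeDecomposition

/-!
# Route MonotoneRestoration, crux `MonotoneRestorationQP` (stmt-15886), line `linear-width` — WEIGHTED DVOŘÁK AT GLUED POINTS
# (helper, def-free)

**Theorem (`homIndist_glued_of_ckEquiv`).**  If the simple graphs `X, Y` on `Fin m` are `≡^{C^k}`-equivalent (`CkEquiv k X Y`,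
tree Dvořák currency), then for every `α ∈ ℂ` the GLUED points `α·I + 1_X` and `α·I + 1_Y` of `ℂ^{m×m}` are hom-indistinguishable
below treewidth `k` in the line's WEIGHTED, TWO-SORTED sense (`HomIndist m k`, `…LinearWidthDefs.lean`) — with the SAME `k`.
With `…LinearWidthHomIndistShift.lean` (p827944) the same holds at every `Sym_m`-fixed base point `α·I + β·(J − I)` and along the
whole pencil `t ↦ a + t·1_X` (`homIndist_pencil_of_ckEquiv`).

Proof.  `hom_E(α·I + N) = Σ_{E = T₁ + T₂} α^{|T₁|} · #{(h₁,h₂) : h₁ p = h₂ q ∀ (p,q) ∈ T₁, X.Adj (h₁ p) (h₂ q) ∀ (p,q) ∈ T₂}`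
(`eval_homPoly_glued`).  The count is `0` if some `T₂`-edge has its ends identified by the `T₁`-identifications (no loops in
`X`), and otherwise the number of graph homomorphisms into `X` from the QUOTIENT of `(Fin a ⊕ Fin b, T₂)` by the equivalence
generated by `T₁` (`card_glued_eq_card_hom`) — a minor of the pattern graph, whose tree decompositions are the images of those
of `patternGraph E` (`quotientDecomposition`, bags do not grow); Dvořák's theorem (`Dvorak2010.card_hom_eq_of_ckEquiv`, PROVED
in the tree) finishes.

Consequences recorded: `multiplier_vanishes_of_ckEquiv_pencil` — the multiplier no-go (`…LinearWidthMultiplierNoGo.lean`,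
p827520) made unconditional relative to a `CkEquiv` pair: a multiplier `D` with `D` and `D·h` hom-determined below treewidth `k`
is ZERO at every invariant base point whose glued pencil through a `≡^{C^k}` pair is separated by `h`;
`gluedDetermined_of_polylogHomDetermined` — the weighted GAP 2 hypothesis (`PolylogHomDetermined`) forces determinedness at all
glued points over `≡^{C^{polylog}}` pairs (one-sorted content), the converse direction of `…OrbitRestorationQPGluedKill.lean`.
Honest label: infrastructure (weighted Dvořák for glued points); nothing closed; VP ≠ VNP untouched.
[cite: Dvorak2010, Thm 6; DwivediPagoSeppelt2026, Def. 3.2]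
-/

-- `Summit.ValiantsHypothesis.ValiantsHypothesis.…` is the tree's mandated namespace (Sub = Summit).
set_option linter.dupNamespace false

noncomputable section

open scoped Classical

namespace Summit.ValiantsHypothesis.ValiantsHypothesis.Theorems

namespace GluedDvorak

open MvPolynomial Finset
open Literature.Computability.AlgebraicComplexity
open Literature.ModelTheory.FiniteModelTheory
open Literature.Combinatorics.SimpleGraph
open MonotoneRestorationQPLinearWidth

variable {a b m : ℕ}

/-! ### 1. Expansion of a homomorphism polynomial at a glued point -/

/-- A product of `0/1` values over a multiset is the indicator that all of them are `1`. [folklore] -/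
theorem prod_map_ite (E : Multiset (Fin a × Fin b)) (P : Fin a × Fin b → Prop) [DecidablePred P] :
    (E.map fun e => (if P e then (1 : ℂ) else 0)).prod = if ∀ e ∈ E, P e then 1 else 0 := by
  induction E using Multiset.induction_on with
  | empty => simp
  | cons x s ih =>
    rw [Multiset.map_cons, Multiset.prod_cons, ih]
    by_cases hx : P x <;> simp [hx]

/-- Product of two `0/1` indicators. [folklore] -/
theorem ite_mul_ite (P Q : Prop) [Decidable P] [Decidable Q] :
    (if P then (1 : ℂ) else 0) * (if Q then (1 : ℂ) else 0) = if P ∧ Q then 1 else 0 := by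
  by_cases hP : P <;> by_cases hQ : Q <;> simp [hP, hQ]

/-- **`hom_E` at a glued point `α·I + 1_X`**: `Σ_{(T₁,T₂) ∈ antidiagonal E} α^{|T₁|} · N(T₁,T₂;X)` with
`N = #{(h₁,h₂) : h₁ p = h₂ q on T₁, X.Adj (h₁ p) (h₂ q) on T₂}`. [folklore] -/
theorem eval_homPoly_glued (E : Multiset (Fin a × Fin b)) (α : ℂ) (X : SimpleGraph (Fin m)) :
    eval (fun ij : Fin m × Fin m => (if ij.1 = ij.2 then α else 0) +
        Set.indicator {ij : Fin m × Fin m | X.Adj ij.1 ij.2} (1 : Fin m × Fin m → ℂ) ij) (homPoly E m ℂ) =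
      ((Multiset.antidiagonal E).map fun p => α ^ Multiset.card p.1 *
        ((univ.filter fun h : (Fin a → Fin m) × (Fin b → Fin m) =>
          (∀ e ∈ p.1, h.1 e.1 = h.2 e.2) ∧ ∀ e ∈ p.2, X.Adj (h.1 e.1) (h.2 e.2)).card : ℂ)).sum := by
  rw [HomIndistShift.eval_homPoly]
  have hind : ∀ ij : Fin m × Fin m,
      Set.indicator {ij : Fin m × Fin m | X.Adj ij.1 ij.2} (1 : Fin m × Fin m → ℂ) ij = if X.Adj ij.1 ij.2 then 1 else 0 := by
    intro ij
    by_cases h : X.Adj ij.1 ij.2 <;> simp [Set.indicator, h]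
  have hexp : ∀ h : (Fin a → Fin m) × (Fin b → Fin m),
      (E.map fun e => ((if (h.1 e.1, h.2 e.2).1 = (h.1 e.1, h.2 e.2).2 then α else 0) +
          Set.indicator {ij : Fin m × Fin m | X.Adj ij.1 ij.2} (1 : Fin m × Fin m → ℂ) (h.1 e.1, h.2 e.2))).prod =
        ((Multiset.antidiagonal E).map fun p => α ^ Multiset.card p.1 *
          ((if ∀ e ∈ p.1, h.1 e.1 = h.2 e.2 then (1 : ℂ) else 0) *
            (if ∀ e ∈ p.2, X.Adj (h.1 e.1) (h.2 e.2) then (1 : ℂ) else 0))).sum := by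
    intro h
    rw [Multiset.prod_map_add]
    refine congrArg _ (Multiset.map_congr rfl fun p _ => ?_)
    have h1 : (p.1.map fun e => (if (h.1 e.1, h.2 e.2).1 = (h.1 e.1, h.2 e.2).2 then α else 0)).prod =
        α ^ Multiset.card p.1 * (if ∀ e ∈ p.1, h.1 e.1 = h.2 e.2 then (1 : ℂ) else 0) := by
      have : (fun e : Fin a × Fin b => (if (h.1 e.1, h.2 e.2).1 = (h.1 e.1, h.2 e.2).2 then α else 0)) =
          fun e => α * (if h.1 e.1 = h.2 e.2 then (1 : ℂ) else 0) := by
        funext e; split_ifs <;> simp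
      rw [this, Multiset.prod_map_mul, Multiset.map_const', Multiset.prod_replicate]
      exact congrArg _ (prod_map_ite p.1 fun e => h.1 e.1 = h.2 e.2)
    have h2 : (p.2.map fun e => Set.indicator {ij : Fin m × Fin m | X.Adj ij.1 ij.2} (1 : Fin m × Fin m → ℂ)
        (h.1 e.1, h.2 e.2)).prod = if ∀ e ∈ p.2, X.Adj (h.1 e.1) (h.2 e.2) then (1 : ℂ) else 0 := by
      simp only [hind]
      exact prod_map_ite p.2 fun e => X.Adj (h.1 e.1) (h.2 e.2)
    rw [h1, h2, mul_assoc]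
  rw [Finset.sum_congr rfl fun h _ => hexp h, Finset.sum_eq_multiset_sum, Multiset.sum_map_sum_map]
  refine congrArg _ (Multiset.map_congr rfl fun p _ => ?_)
  rw [← Finset.sum_eq_multiset_sum, ← Finset.mul_sum, natCast_card_filter]
  congr 1
  exact sum_congr rfl fun h _ => ite_mul_ite _ _

/-! ### 2. The count as a number of graph homomorphisms from the quotient pattern -/

/-- Well-definedness: a pair of vertex maps satisfying the `T₁`-equalities is constant on the classes of the equivalence
generated by the `T₁`-identifications. [folklore] -/
theorem elim_eq_of_eqvGen (T₁ : Multiset (Fin a × Fin b)) (r : Fin a ⊕ Fin b → Fin a ⊕ Fin b → Prop)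
    (hr' : ∀ u v, r u v → ∃ e ∈ T₁, u = Sum.inl e.1 ∧ v = Sum.inr e.2)
    (φ : Fin a → Fin m) (ψ : Fin b → Fin m) (hT₁ : ∀ e ∈ T₁, φ e.1 = ψ e.2) {u v : Fin a ⊕ Fin b}
    (huv : Relation.EqvGen r u v) : Sum.elim φ ψ u = Sum.elim φ ψ v := by
  induction huv with
  | rel x y hxy =>
    obtain ⟨e, he, rfl, rfl⟩ := hr' x y hxy
    exact hT₁ e he
  | refl x => rfl
  | symm x y _ ih => exact ih.symm
  | trans x y z _ _ ih1 ih2 => exact ih1.trans ih2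

/-- **Collapsed case**: if a `T₂`-edge has its two ends identified, no pair of vertex maps satisfies the constraints (the target
graph has no loops). [folklore] -/
theorem card_filter_eq_zero_of_collapsed (X : SimpleGraph (Fin m)) (T₁ T₂ : Multiset (Fin a × Fin b))
    (r : Fin a ⊕ Fin b → Fin a ⊕ Fin b → Prop)
    (hr' : ∀ u v, r u v → ∃ e ∈ T₁, u = Sum.inl e.1 ∧ v = Sum.inr e.2)
    (hc : ∃ e ∈ T₂, Quot.mk r (Sum.inl e.1) = Quot.mk r (Sum.inr e.2)) :
    (univ.filter fun h : (Fin a → Fin m) × (Fin b → Fin m) =>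
      (∀ e ∈ T₁, h.1 e.1 = h.2 e.2) ∧ ∀ e ∈ T₂, X.Adj (h.1 e.1) (h.2 e.2)).card = 0 := by
  rw [Finset.card_eq_zero, Finset.filter_eq_empty_iff]
  rintro h - ⟨h1, h2⟩
  obtain ⟨e, he, hmk⟩ := hc
  have heq := elim_eq_of_eqvGen T₁ r hr' h.1 h.2 h1 (Quot.eqvGen_exact hmk)
  simp only [Sum.elim_inl, Sum.elim_inr] at heq
  have := h2 e he
  rw [heq] at this
  exact X.irrefl this

/-- **Non-collapsed case**: the constrained pairs of vertex maps are in bijection with the graph homomorphisms from the quotient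
pattern (vertices `Fin a ⊕ Fin b` modulo the `T₁`-identifications, edges from `T₂`). [folklore] -/
theorem card_filter_eq_natCard_hom (X : SimpleGraph (Fin m)) (T₁ T₂ : Multiset (Fin a × Fin b))
    (r : Fin a ⊕ Fin b → Fin a ⊕ Fin b → Prop) (hr : ∀ e ∈ T₁, r (Sum.inl e.1) (Sum.inr e.2))
    (hr' : ∀ u v, r u v → ∃ e ∈ T₁, u = Sum.inl e.1 ∧ v = Sum.inr e.2)
    (hnc : ∀ e ∈ T₂, Quot.mk r (Sum.inl e.1) ≠ Quot.mk r (Sum.inr e.2)) :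
    (univ.filter fun h : (Fin a → Fin m) × (Fin b → Fin m) =>
      (∀ e ∈ T₁, h.1 e.1 = h.2 e.2) ∧ ∀ e ∈ T₂, X.Adj (h.1 e.1) (h.2 e.2)).card =
      Nat.card (SimpleGraph.fromRel (fun x y : Quot r =>
        ∃ e ∈ T₂, x = Quot.mk r (Sum.inl e.1) ∧ y = Quot.mk r (Sum.inr e.2)) →g X) := by
  rw [← Fintype.card_subtype, ← Nat.card_eq_fintype_card]
  refine Nat.card_congr
    { toFun := fun h =>
        { toFun := Quot.lift (Sum.elim h.1.1 h.1.2) (fun u v huv => by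
            obtain ⟨e, he, rfl, rfl⟩ := hr' u v huv
            simpa using h.2.1 e he)
          map_rel' := ?_ }
      invFun := fun g => ⟨(fun p => g (Quot.mk r (Sum.inl p)), fun q => g (Quot.mk r (Sum.inr q))), ?_, ?_⟩
      left_inv := fun h => by ext <;> rfl
      right_inv := fun g => by
        apply RelHom.ext
        intro x
        induction x using Quot.ind with
        | mk u => cases u <;> rfl }
  · intro x y hxy
    rw [SimpleGraph.fromRel_adj] at hxy
    obtain ⟨-, ⟨e, he, rfl, rfl⟩ | ⟨e, he, rfl, rfl⟩⟩ := hxy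
    · simpa using h.2.2 e he
    · simpa using (h.2.2 e he).symm
  · intro e he
    exact congrArg g (Quot.sound (hr e he))
  · intro e he
    refine g.map_rel ?_
    rw [SimpleGraph.fromRel_adj]
    exact ⟨hnc e he, Or.inl ⟨e, he, rfl, rfl⟩⟩

/-! ### 3. Tree decompositions descend to the quotient pattern (minors do not increase width) -/

/-- **The quotient pattern inherits a tree decomposition** from the pattern graph of `E ⊇ T₁, T₂`, with the same tree and the
images of the bags (so bags do not grow). [folklore] -/
theorem exists_quotientDecomposition {ι : Type*} (E T₁ T₂ : Multiset (Fin a × Fin b)) (hT₁ : T₁ ≤ E) (hT₂ : T₂ ≤ E)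
    (r : Fin a ⊕ Fin b → Fin a ⊕ Fin b → Prop)
    (hr' : ∀ u v, r u v → ∃ e ∈ T₁, u = Sum.inl e.1 ∧ v = Sum.inr e.2)
    (D : TreeDecomposition (patternGraph E) ι) :
    ∃ D' : TreeDecomposition (SimpleGraph.fromRel (fun x y : Quot r =>
        ∃ e ∈ T₂, x = Quot.mk r (Sum.inl e.1) ∧ y = Quot.mk r (Sum.inr e.2))) ι,
      ∀ t, (D'.bag t).card ≤ (D.bag t).card := by
  -- the pattern graph of `E` contains every `E`-edge
  have hadjE : ∀ e ∈ E, (patternGraph E).Adj (Sum.inl e.1) (Sum.inr e.2) := by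
    intro e he
    rw [patternGraph, SimpleGraph.fromRel_adj]
    exact ⟨Sum.inl_ne_inr, Or.inl ⟨e, he, rfl, rfl⟩⟩
  -- reachability inside the region of one pattern vertex, transported to a larger induced subgraph
  have hreach : ∀ (U : Set ι) (u : Fin a ⊕ Fin b) (hU : {t | u ∈ D.bag t} ⊆ U) (s₁ s₂ : U)
      (h₁ : u ∈ D.bag s₁.1) (h₂ : u ∈ D.bag s₂.1), (D.tree.induce U).Reachable s₁ s₂ := by
    intro U u hU s₁ s₂ h₁ h₂
    have hc := (D.connected_induce u).preconnected ⟨s₁.1, h₁⟩ ⟨s₂.1, h₂⟩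
    exact hc.map (D.tree.induceHomOfLE hU).toHom
  refine ⟨{ tree := D.tree
            isTree := D.isTree
            bag := fun t => (D.bag t).image (Quot.mk r)
            exists_mem_bag_of_adj := ?_
            connected_induce := ?_ }, fun t => Finset.card_image_le⟩
  · intro x y hxy
    rw [SimpleGraph.fromRel_adj] at hxy
    obtain ⟨-, ⟨e, he, rfl, rfl⟩ | ⟨e, he, rfl, rfl⟩⟩ := hxy
    · obtain ⟨t, hu, hv⟩ := D.exists_mem_bag_of_adj (hadjE e (Multiset.mem_of_le hT₂ he))
      exact ⟨t, Finset.mem_image_of_mem _ hu, Finset.mem_image_of_mem _ hv⟩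
    · obtain ⟨t, hu, hv⟩ := D.exists_mem_bag_of_adj (hadjE e (Multiset.mem_of_le hT₂ he))
      exact ⟨t, Finset.mem_image_of_mem _ hv, Finset.mem_image_of_mem _ hu⟩
  · intro x
    set U : Set ι := {t | x ∈ (D.bag t).image (Quot.mk r)} with hU
    -- regions of representatives of `x` lie inside `U`
    have hsub : ∀ u : Fin a ⊕ Fin b, Quot.mk r u = x → {t | u ∈ D.bag t} ⊆ U := by
      intro u hux t ht
      exact Finset.mem_image.2 ⟨u, ht, hux⟩
    -- the chain argument along the generating identifications
    have key : ∀ u v : Fin a ⊕ Fin b, Relation.EqvGen r u v → Quot.mk r u = x →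
        ∀ s₁ s₂ : U, u ∈ D.bag s₁.1 → v ∈ D.bag s₂.1 → (D.tree.induce U).Reachable s₁ s₂ := by
      intro u v huv
      induction huv with
      | rel y z hyz =>
        intro hyx s₁ s₂ h₁ h₂
        obtain ⟨e, he, rfl, rfl⟩ := hr' y z hyz
        have hzx : Quot.mk r (Sum.inr e.2) = x := by rw [← hyx]; exact (Quot.sound hyz).symm
        obtain ⟨t₀, hu₀, hv₀⟩ := D.exists_mem_bag_of_adj (hadjE e (Multiset.mem_of_le hT₁ he))
        have h0 : t₀ ∈ U := hsub _ hyx hu₀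
        exact (hreach U _ (hsub _ hyx) s₁ ⟨t₀, h0⟩ h₁ hu₀).trans (hreach U _ (hsub _ hzx) ⟨t₀, h0⟩ s₂ hv₀ h₂)
      | refl y =>
        intro hyx s₁ s₂ h₁ h₂
        exact hreach U _ (hsub _ hyx) s₁ s₂ h₁ h₂
      | symm y z hyz ih =>
        intro hzx s₁ s₂ h₁ h₂
        have hyx : Quot.mk r y = x := by rw [← hzx]; exact Quot.eqvGen_sound hyz
        exact (ih hyx s₂ s₁ h₂ h₁).symm
      | trans y w z hyw _ ih1 ih2 =>
        intro hyx s₁ s₂ h₁ h₂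
        have hwx : Quot.mk r w = x := by rw [← hyx]; exact (Quot.eqvGen_sound hyw).symm
        obtain ⟨t, ht⟩ := D.exists_mem_bag w
        exact (ih1 hyx s₁ ⟨t, hsub _ hwx ht⟩ h₁ ht).trans (ih2 hwx ⟨t, hsub _ hwx ht⟩ s₂ ht h₂)
    rw [SimpleGraph.connected_iff_exists_forall_reachable]
    obtain ⟨v₀, hv₀⟩ := Quot.exists_rep x
    obtain ⟨t₀, ht₀⟩ := D.exists_mem_bag v₀
    refine ⟨⟨t₀, hsub _ hv₀ ht₀⟩, fun s => ?_⟩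
    obtain ⟨v, hv, hvx⟩ := Finset.mem_image.1 s.2
    have hvv : Relation.EqvGen r v₀ v := Quot.eqvGen_exact (hv₀.trans hvx.symm)
    exact key v₀ v hvv hv₀ ⟨t₀, hsub _ hv₀ ht₀⟩ s ht₀ hv

/-! ### 4. Weighted Dvořák at glued points -/

/-- **WEIGHTED DVOŘÁK AT GLUED POINTS.**  `X ≡^{C^k} Y` implies that `α·I + 1_X` and `α·I + 1_Y` are hom-indistinguishable below
treewidth `k` (two-sorted, weighted), for every `α`. [cite: Dvorak2010, Thm 6] -/
theorem homIndist_glued_of_ckEquiv {k : ℕ} {X Y : SimpleGraph (Fin m)} (h : CkEquiv k X Y) (α : ℂ) :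
    HomIndist m k
      (fun ij : Fin m × Fin m => (if ij.1 = ij.2 then α else 0) +
        Set.indicator {ij : Fin m × Fin m | X.Adj ij.1 ij.2} (1 : Fin m × Fin m → ℂ) ij)
      (fun ij : Fin m × Fin m => (if ij.1 = ij.2 then α else 0) +
        Set.indicator {ij : Fin m × Fin m | Y.Adj ij.1 ij.2} (1 : Fin m × Fin m → ℂ) ij) := by
  intro a b E htw
  rw [eval_homPoly_glued, eval_homPoly_glued]
  refine congrArg _ (Multiset.map_congr rfl fun p hp => ?_)
  have hsum : p.1 + p.2 = E := Multiset.mem_antidiagonal.1 hp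
  have hT₁ : p.1 ≤ E := by rw [← hsum]; exact Multiset.le_add_right _ _
  have hT₂ : p.2 ≤ E := by rw [← hsum]; exact Multiset.le_add_left _ _
  -- the identification relation generated by `T₁ = p.1`
  set r : Fin a ⊕ Fin b → Fin a ⊕ Fin b → Prop := fun u v => ∃ e ∈ p.1, u = Sum.inl e.1 ∧ v = Sum.inr e.2 with hr
  have hr₁ : ∀ e ∈ p.1, r (Sum.inl e.1) (Sum.inr e.2) := fun e he => ⟨e, he, rfl, rfl⟩
  have hr' : ∀ u v, r u v → ∃ e ∈ p.1, u = Sum.inl e.1 ∧ v = Sum.inr e.2 := fun u v huv => huv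
  have key : (univ.filter fun hh : (Fin a → Fin m) × (Fin b → Fin m) =>
        (∀ e ∈ p.1, hh.1 e.1 = hh.2 e.2) ∧ ∀ e ∈ p.2, X.Adj (hh.1 e.1) (hh.2 e.2)).card =
      (univ.filter fun hh : (Fin a → Fin m) × (Fin b → Fin m) =>
        (∀ e ∈ p.1, hh.1 e.1 = hh.2 e.2) ∧ ∀ e ∈ p.2, Y.Adj (hh.1 e.1) (hh.2 e.2)).card := by
    by_cases hc : ∃ e ∈ p.2, Quot.mk r (Sum.inl e.1) = Quot.mk r (Sum.inr e.2)
    · rw [card_filter_eq_zero_of_collapsed X p.1 p.2 r hr' hc, card_filter_eq_zero_of_collapsed Y p.1 p.2 r hr' hc]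
    · push Not at hc
      rw [card_filter_eq_natCard_hom X p.1 p.2 r hr₁ hr' hc, card_filter_eq_natCard_hom Y p.1 p.2 r hr₁ hr' hc]
      rcases Nat.eq_zero_or_pos k with hk | hk
      · omega
      obtain ⟨j, D, hD⟩ := exists_width_eq_treewidth (patternGraph E)
      obtain ⟨D', hD'⟩ := exists_quotientDecomposition E p.1 p.2 hT₁ hT₂ r hr' D
      haveI : Fintype (Quot r) := Fintype.ofFinite _
      exact Dvorak2010.card_hom_eq_of_ckEquiv hk h D' fun t => (hD' t).trans (by
        have := D.card_bag_le_width_add_one t; omega)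
  rw [key]

/-! ### 5. Consequences: pencils through invariant base points; the multiplier no-go made unconditional; GAP 2 ⇒ glued H₁ -/

/-- **Glued pencils through every invariant base point.**  `X ≡^{C^k} Y` implies that for every `Sym_m`-fixed base point
`a = α·I + β·(J − I)` and every `t`, the points `a + t·1_X` and `a + t·1_Y` are hom-indistinguishable below treewidth `k`.
[cite: Dvorak2010, Thm 6] -/
theorem homIndist_pencil_of_ckEquiv {k : ℕ} {X Y : SimpleGraph (Fin m)} (h : CkEquiv k X Y) (α β t : ℂ) :
    HomIndist m k
      (fun ij : Fin m × Fin m => (if ij.1 = ij.2 then α else β) +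
        t * Set.indicator {ij : Fin m × Fin m | X.Adj ij.1 ij.2} (1 : Fin m × Fin m → ℂ) ij)
      (fun ij : Fin m × Fin m => (if ij.1 = ij.2 then α else β) +
        t * Set.indicator {ij : Fin m × Fin m | Y.Adj ij.1 ij.2} (1 : Fin m × Fin m → ℂ) ij) := by
  by_cases ht : t = 0
  · subst ht
    intro a' b' E _
    simp only [zero_mul, add_zero]
  · have key := HomIndistShift.homIndist_affine (homIndist_glued_of_ckEquiv h ((α - β) / t)) t β
    convert key using 2 <;> split_ifs <;> field_simp <;> ring

/-- **THE MULTIPLIER NO-GO, UNCONDITIONALLY FROM A `≡^{C^k}` PAIR** (`…LinearWidthMultiplierNoGo.lean` with the pencils supplied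
by `homIndist_pencil_of_ckEquiv`): if `X ≡^{C^k} Y`, `D` and `D·h` are hom-determined below treewidth `k`, and `h` separates the
glued points `a + t₀·1_X`, `a + t₀·1_Y` for some `t₀` at the invariant base point `a = α·I + β·(J − I)`, then `D(a) = 0` — no
Strassen division by `D` at `a`. [folklore] -/
theorem multiplier_vanishes_of_ckEquiv_pencil {k : ℕ} {X Y : SimpleGraph (Fin m)} (hXY : CkEquiv k X Y) (α β : ℂ)
    {D h : MvPolynomial (Fin m × Fin m) ℂ}
    (hD : ∀ A B, HomIndist m k A B → eval A D = eval B D)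
    (hDh : ∀ A B, HomIndist m k A B → eval A (D * h) = eval B (D * h))
    (hsep : ∃ t₀ : ℂ,
      eval (fun ij : Fin m × Fin m => (if ij.1 = ij.2 then α else β) +
        t₀ * Set.indicator {ij : Fin m × Fin m | X.Adj ij.1 ij.2} (1 : Fin m × Fin m → ℂ) ij) h ≠
      eval (fun ij : Fin m × Fin m => (if ij.1 = ij.2 then α else β) +
        t₀ * Set.indicator {ij : Fin m × Fin m | Y.Adj ij.1 ij.2} (1 : Fin m × Fin m → ℂ) ij) h) :
    eval (fun ij : Fin m × Fin m => if ij.1 = ij.2 then α else β) D = 0 :=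
  MultiplierNoGo.eval_eq_zero_of_homDetermined_pencil
    (fun ij : Fin m × Fin m => if ij.1 = ij.2 then α else β)
    (Set.indicator {ij : Fin m × Fin m | X.Adj ij.1 ij.2} (1 : Fin m × Fin m → ℂ))
    (Set.indicator {ij : Fin m × Fin m | Y.Adj ij.1 ij.2} (1 : Fin m × Fin m → ℂ))
    (fun t => homIndist_pencil_of_ckEquiv hXY α β t) hD hDh hsep

/-- **GAP 2 ⇒ GLUED H₁**: a polylog-hom-determined family (the weighted hypothesis of line `linear_width`) takes equal values at
the glued points `α·I + β·(J − I) + t·1_X`, `… + t·1_Y` over every `≡^{C^{(log₂ m + c)^c}}` pair — the one-sorted content of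
`HomDeterminedVP`, converse in direction to the kill format of `…OrbitRestorationQPGluedKill.lean`. [folklore] -/
theorem gluedDetermined_of_polylogHomDetermined {f : (n : ℕ) → MvPolynomial (Fin n × Fin n) ℂ}
    (hf : PolylogHomDetermined f) :
    ∃ c : ℕ, ∀ (m : ℕ) (α β t : ℂ) (X Y : SimpleGraph (Fin m)), CkEquiv ((Nat.log 2 m + c) ^ c) X Y →
      eval (fun ij : Fin m × Fin m => (if ij.1 = ij.2 then α else β) +
        t * Set.indicator {ij : Fin m × Fin m | X.Adj ij.1 ij.2} (1 : Fin m × Fin m → ℂ) ij) (f m) =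
      eval (fun ij : Fin m × Fin m => (if ij.1 = ij.2 then α else β) +
        t * Set.indicator {ij : Fin m × Fin m | Y.Adj ij.1 ij.2} (1 : Fin m × Fin m → ℂ) ij) (f m) := by
  obtain ⟨c, hc⟩ := hf
  exact ⟨c, fun m α β t X Y hXY => hc m _ _ (homIndist_pencil_of_ckEquiv hXY α β t)⟩

end GluedDvorak

end Summit.ValiantsHypothesis.ValiantsHypothesis.Theorems

end
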